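import Literature.IUT.LogVolume.TameQuadraticIsometryStable
import Literature.IUT.LogVolume.TameDualPair
import Literature.IUT.LogVolume.PacketDifferent
import Literature.IUT.LogVolume.IntegralBases
import HarnessLib

/-!
# Isometries FIX the maximal order of the two-slot packet on the whole residual dyadic class (residue field `𝔽₂`, `d = e`) — ANY degree

Classical local algebra (nothing disputed; the [IUTchIV] locator records where the abc-iut cell uses it).  [IUTchIV] Prop. 1.1 p. 9:
the maximal `ℤ_p`-order `(R_I)^∼` of a tensor packet (campaign-S `normalizedPacket`).  The abc-iut cell's Y-29b «trace-kernel
criterion» (`Joshi/TestRealPinsIsometricTraceKernelShear`) exhibits isometric MOVERS of `(R_I)^∼` at every wild place EXCEPT on the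
residual class «residue field `𝔽_p` and `Tr(π⁻¹𝒪_K) ⊄ p·ℤ_p`» (at `p = 2`: `f = 1`, `d = e`); `DyadicDiffTwoIsometryStable` proved
STABILITY on its two quadratic members `ℚ₂(√−1)`, `ℚ₂(√3)` by explicit coordinates.  THIS FILE proves stability on the WHOLE class, in
every degree, with no coordinates on `K`: if (i) every unit `w` has `‖w − 1‖ < 1` (residue field `𝔽₂`), (ii) `π` is a uniformizer
(`‖y‖ < 1 ⇒ ‖y‖ ≤ ‖π‖`), (iii) some `x₀` with `‖x₀‖ ≤ ‖π‖⁻¹` has `‖Tr x₀‖ ≥ 1` (`d ≤ e`), then EVERY pair of `ℚ_p`-linear isometries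
`f₀, f₁` of `K` satisfies `(f₀ ⊗ f₁)((R_I)^∼) ⊆ (R_I)^∼` in `K ⊗_{ℚ_p} K`.  Steps:
* §1 `mem_of_rankOne` — for `‖u‖·‖t‖ ≤ 1` the slot-`0` rank-one map `x ↦ Tr(t x)·u` sends `(R_I)^∼` into itself:
  `((u·Tr(t·)) ⊗ 1)(z) = ι₀(u)·ι₁(Tr_{V/K}((t ⊗ 1)·z))` (trace RELATIVE to the second slot, campaign-S `relTrace_purePacket`),
  `(t ⊗ 1) = (1 ⊗ t)·(t ⊗ t⁻¹)`, `t ⊗ t⁻¹ ∈ (R_I)^∼`, `Tr_{V/K}((R_I)^∼) ⊆ 𝒪_K` (`norm_relTrace_le_one`): the image is `u ⊗ (t·r)`, `‖r‖ ≤ 1`;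
* §2 `norm_mul_le_one_of_strict` — a STRICTLY contracting rank-one map (`‖Tr(t x)‖·‖u‖ < ‖x‖`, `x ≠ 0`) has `‖u‖·‖t‖ ≤ 1` under
  (ii)–(iii): test at `x = t⁻¹x₀`, then use the value group;
* §3 under (i) an isometry `σ` has `‖σ x − x‖ < ‖x‖` (`norm_sub_lt_of_isometry`); along a NORM-DOMINATED basis `b` (abc-iut-E-t42's
  `TameDualPair.exists_dominated_basis`) `σ − 1 = Σ_j Tr(t_j ·)·(σ b_j − b_j)` (`exists_traceDual_basis`), each piece strictly contracting,
  whence **`congr_left_mem_normalizedPacket_of_isometry`**; §4 the second slot symmetrically, pairs, and **`not_exists_isometry_mover`**.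
Use (abc-iut cell, R-J row Y-29b dyadic wording): «`p = 2`: an isometric mover of `(R_I)^∼ ⊆ K_w ⊗ K_w` exists iff `K_w` is wild and NOT
(`f_w = 1 ∧ d_w = e_w`)»; the residual class (`ℚ₂(√−1)`, `ℚ₂(√3)`, `ℚ₂[x]/(x⁴ + 2x + 2)`, …, any degree) is STABLE.  CONTAINERS only;
no side is taken on [IUTchIII] Cor. 3.12.  Proof-only file (theorems, no definitions).
[cite: Mochizuki2012, IUTchIV Prop. 1.1 p. 9, Prop. 1.4 (i) p. 13] [cite: SerreLocalFields1979, Ch. III §3, Prop. 7]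
[cite: WeilBNT1967, Ch. II §1, Prop. 3]
-/

noncomputable section

open Metric Set Function
open scoped TensorProduct

namespace Literature.IUT.LogVolume

namespace DyadicPrimeResidue

variable {p : ℕ} [Fact p.Prime]
variable {K : Type} [NontriviallyNormedField K] [NormedAlgebra ℚ_[p] K] [IsUltrametricDist K] [ProperSpace K]

/-! ## §0 Two-slot packet bookkeeping -/

/-- `x ⊗ y ∈ (R_I)^∼` whenever `‖x‖·‖y‖ ≤ 1` (every field-factor coordinate is `ψ_j(ι₀ x)·ψ_j(ι₁ y)`; any prime).
[cite: Mochizuki2012, IUTchIV Prop. 1.4 (i) p. 13] -/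
theorem purePacket_pair_mem {x y : K} (h : ‖x‖ * ‖y‖ ≤ 1) :
    purePacket p (fun _ : Fin 2 => K) ![x, y] ∈ normalizedPacket p (fun _ : Fin 2 => K) :=
  TameQuadratic.mem_normalizedPacket_of_norm_dEquiv_le fun j => by
    rw [TameQuadratic.dEquiv_purePacket_pair, norm_mul, norm_dEquiv_iota, norm_dEquiv_iota]; exact h

omit [IsUltrametricDist K] [ProperSpace K] in
/-- `ι₀(a)·(x ⊗ y) = (a x) ⊗ y`. [cite: Mochizuki2012, IUTchIV Prop. 1.1 p. 9] -/
theorem iota_zero_mul_purePacket_pair (a x y : K) :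
    iota p (fun _ : Fin 2 => K) 0 a * purePacket p (fun _ : Fin 2 => K) ![x, y] = purePacket p (fun _ : Fin 2 => K) ![a * x, y] := by
  rw [TameQuadratic.purePacket_pair_eq_iota_mul, TameQuadratic.purePacket_pair_eq_iota_mul, map_mul, mul_assoc]

omit [IsUltrametricDist K] [ProperSpace K] in
/-- `ι₁(a)·(x ⊗ y) = x ⊗ (a y)`. [cite: Mochizuki2012, IUTchIV Prop. 1.1 p. 9] -/
theorem iota_one_mul_purePacket_pair (a x y : K) :
    iota p (fun _ : Fin 2 => K) 1 a * purePacket p (fun _ : Fin 2 => K) ![x, y] = purePacket p (fun _ : Fin 2 => K) ![x, a * y] := by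
  rw [TameQuadratic.purePacket_pair_eq_iota_mul, TameQuadratic.purePacket_pair_eq_iota_mul, map_mul, mul_left_comm]

/-- **The trace relative to the second slot of a pure tensor**: `Tr_{V/K}(x ⊗ y) = Tr_{K/ℚ_p}(x)·y` for the `K`-algebra structure
`a ↦ 1 ⊗ a = ι₁(a)` (campaign-S `relTrace_purePacket` at `* = 1`). [cite: Mochizuki2012, IUTchIV Prop. 1.1 p. 9] -/
theorem relTrace_purePacket_pair [Algebra K (PacketAlgebra p (fun _ : Fin 2 => K))]
    (hV : ∀ a : K, algebraMap K (PacketAlgebra p (fun _ : Fin 2 => K)) a = iota p (fun _ : Fin 2 => K) 1 a) (x y : K) :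
    Algebra.trace K (PacketAlgebra p (fun _ : Fin 2 => K)) (purePacket p (fun _ : Fin 2 => K) ![x, y]) =
      Algebra.trace ℚ_[p] K x • y := by
  classical
  rw [relTrace_purePacket p (fun _ : Fin 2 => K) 1 hV]
  have h01 : (Finset.univ : Finset (Fin 2)).erase 1 = {0} := by decide
  rw [h01, Finset.prod_singleton, Algebra.smul_def, mul_comm]
  rfl

/-! ## §1 A slot-`0` rank-one map `x ↦ Tr(t x)·u` with `‖u‖·‖t‖ ≤ 1` sends `(R_I)^∼` into itself -/

/-- **`ι₀(u)·ι₁(Tr_{V/K}((t ⊗ 1)·z)) ∈ (R_I)^∼`** for `z ∈ (R_I)^∼` and `‖u‖·‖t‖ ≤ 1` (`(t ⊗ 1)·z = (1 ⊗ t)·((t ⊗ t⁻¹)·z)`,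
`t ⊗ t⁻¹ ∈ (R_I)^∼`, `Tr_{V/K}((R_I)^∼) ⊆ 𝒪_K`). [cite: Mochizuki2012, IUTchIV Prop. 1.1 p. 9] [cite: SerreLocalFields1979, Ch. III §3, Prop. 7] -/
theorem mem_of_rankOne [Algebra K (PacketAlgebra p (fun _ : Fin 2 => K))]
    (hV : ∀ a : K, algebraMap K (PacketAlgebra p (fun _ : Fin 2 => K)) a = iota p (fun _ : Fin 2 => K) 1 a)
    {u t : K} (hut : ‖u‖ * ‖t‖ ≤ 1) {z : PacketAlgebra p (fun _ : Fin 2 => K)} (hz : z ∈ normalizedPacket p (fun _ : Fin 2 => K)) :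
    iota p (fun _ : Fin 2 => K) 0 u *
        iota p (fun _ : Fin 2 => K) 1
          (Algebra.trace K (PacketAlgebra p (fun _ : Fin 2 => K)) (iota p (fun _ : Fin 2 => K) 0 t * z)) ∈
      normalizedPacket p (fun _ : Fin 2 => K) := by
  by_cases ht : t = 0
  · rw [ht, map_zero, zero_mul, map_zero, map_zero, mul_zero]
    exact Subring.zero_mem _
  set E : PacketAlgebra p (fun _ : Fin 2 => K) := purePacket p (fun _ : Fin 2 => K) ![t, t⁻¹] with hE
  have hEmem : E ∈ normalizedPacket p (fun _ : Fin 2 => K) :=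
    purePacket_pair_mem (by rw [norm_inv, mul_inv_cancel₀ (norm_ne_zero_iff.mpr ht)])
  have hsplit : iota p (fun _ : Fin 2 => K) 0 t * z = iota p (fun _ : Fin 2 => K) 1 t * (E * z) := by
    rw [← mul_assoc, hE, iota_one_mul_purePacket_pair, mul_inv_cancel₀ ht, TameQuadratic.purePacket_pair_eq_iota_mul, map_one, mul_one]
  have htr : Algebra.trace K (PacketAlgebra p (fun _ : Fin 2 => K)) (iota p (fun _ : Fin 2 => K) 0 t * z) =
      t * Algebra.trace K (PacketAlgebra p (fun _ : Fin 2 => K)) (E * z) := by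
    rw [hsplit, ← hV, ← Algebra.smul_def, LinearMap.map_smul, smul_eq_mul]
  have hr : ‖Algebra.trace K (PacketAlgebra p (fun _ : Fin 2 => K)) (E * z)‖ ≤ 1 :=
    norm_relTrace_le_one p (fun _ : Fin 2 => K) 1 hV ((normalizedPacket p (fun _ : Fin 2 => K)).mul_mem hEmem hz)
  rw [htr, ← TameQuadratic.purePacket_pair_eq_iota_mul]
  refine purePacket_pair_mem ?_
  calc ‖u‖ * ‖t * Algebra.trace K (PacketAlgebra p (fun _ : Fin 2 => K)) (E * z)‖
      = ‖u‖ * ‖t‖ * ‖Algebra.trace K (PacketAlgebra p (fun _ : Fin 2 => K)) (E * z)‖ := by rw [norm_mul, mul_assoc]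
    _ ≤ 1 * 1 := by gcongr
    _ = 1 := one_mul 1

/-! ## §2 Strict contraction forces `‖u‖·‖t‖ ≤ 1` when `d ≤ e` -/

omit [IsUltrametricDist K] [ProperSpace K] in
/-- **A STRICTLY contracting rank-one map has `‖u‖·‖t‖ ≤ 1`** when `‖x₀‖ ≤ ‖π‖⁻¹`, `‖Tr x₀‖ ≥ 1` (`d ≤ e`): test at `x = t⁻¹x₀`
(`‖u‖·‖t‖ < ‖π‖⁻¹`), then the value group (`‖y‖ < 1 ⇒ ‖y‖ ≤ ‖π‖` at `y = (u t)⁻¹`). [cite: SerreLocalFields1979, Ch. III §3, Prop. 7] -/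
theorem norm_mul_le_one_of_strict (π : K) (hπmax : ∀ y : K, ‖y‖ < 1 → ‖y‖ ≤ ‖π‖)
    (x₀ : K) (hx₀ : ‖x₀‖ ≤ ‖π‖⁻¹) (htr₀ : 1 ≤ ‖Algebra.trace ℚ_[p] K x₀‖)
    {u t : K} (hM : ∀ x : K, x ≠ 0 → ‖Algebra.trace ℚ_[p] K (t * x)‖ * ‖u‖ < ‖x‖) : ‖u‖ * ‖t‖ ≤ 1 := by
  by_cases ht : t = 0
  · rw [ht, norm_zero, mul_zero]; exact zero_le_one
  by_cases hu : u = 0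
  · rw [hu, norm_zero, zero_mul]; exact zero_le_one
  have hx₀0 : x₀ ≠ 0 := fun h => by
    rw [h, map_zero, norm_zero] at htr₀; exact not_lt.mpr htr₀ zero_lt_one
  have hπ0 : 0 < ‖π‖ := by
    by_contra hle
    have hπz : ‖π‖ = 0 := le_antisymm (not_lt.mp hle) (norm_nonneg _)
    rw [hπz, inv_zero] at hx₀
    exact hx₀0 (norm_le_zero_iff.mp hx₀)
  have hx : t⁻¹ * x₀ ≠ 0 := mul_ne_zero (inv_ne_zero ht) hx₀0
  have key := hM (t⁻¹ * x₀) hx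
  rw [mul_inv_cancel_left₀ ht, norm_mul, norm_inv] at key
  have hupos : 0 < ‖u‖ := norm_pos_iff.mpr hu
  have htpos : 0 < ‖t‖ := norm_pos_iff.mpr ht
  have h1 : ‖u‖ * ‖t‖ < ‖π‖⁻¹ := by
    have h2 : ‖u‖ ≤ ‖Algebra.trace ℚ_[p] K x₀‖ * ‖u‖ := le_mul_of_one_le_left hupos.le htr₀
    have h3 : ‖u‖ < ‖t‖⁻¹ * ‖π‖⁻¹ := h2.trans_lt (key.trans_le (by gcongr))
    calc ‖u‖ * ‖t‖ < ‖t‖⁻¹ * ‖π‖⁻¹ * ‖t‖ := by gcongr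
      _ = ‖π‖⁻¹ := by field_simp
  -- value group: `‖u t‖ > 1` would give `‖(u t)⁻¹‖ ≤ ‖π‖`, i.e. `‖u t‖ ≥ ‖π‖⁻¹`
  by_contra hgt
  rw [not_le] at hgt
  have hut0 : u * t ≠ 0 := mul_ne_zero hu ht
  have hinv : ‖(u * t)⁻¹‖ < 1 := by
    rw [norm_inv, norm_mul]; exact inv_lt_one_of_one_lt₀ hgt
  have hle := hπmax _ hinv
  rw [norm_inv, norm_mul] at hle
  have : ‖π‖⁻¹ ≤ ‖u‖ * ‖t‖ := (inv_le_comm₀ hπ0 (zero_lt_one.trans hgt)).mpr hle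
  exact not_lt.mpr this h1

/-! ## §3 Residue field `𝔽₂`: every isometry is `1 +` strictly contracting, and fixes `(R_I)^∼` -/

omit [IsUltrametricDist K] [ProperSpace K] in
/-- **Rigidity of isometries over residue field `𝔽₂`**: if every unit `w` has `‖w − 1‖ < 1`, then a norm-preserving `σ` satisfies
`‖σ x − x‖ < ‖x‖` for `x ≠ 0` (`σ x = w·x` with `w = σ(x)/x` a unit). [cite: SerreLocalFields1979, Ch. III §3, Prop. 7] -/
theorem norm_sub_lt_of_isometry (hres : ∀ w : K, ‖w‖ = 1 → ‖w - 1‖ < 1) (σ : K ≃ₗ[ℚ_[p]] K) (hσ : ∀ x, ‖σ x‖ = ‖x‖)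
    {x : K} (hx : x ≠ 0) : ‖σ x - x‖ < ‖x‖ := by
  have hw : ‖σ x * x⁻¹‖ = 1 := by rw [norm_mul, norm_inv, hσ, mul_inv_cancel₀ (norm_ne_zero_iff.mpr hx)]
  have h := hres _ hw
  have hxpos : 0 < ‖x‖ := norm_pos_iff.mpr hx
  calc ‖σ x - x‖ = ‖(σ x * x⁻¹ - 1) * x‖ := by rw [sub_mul, inv_mul_cancel_right₀ hx, one_mul]
    _ = ‖σ x * x⁻¹ - 1‖ * ‖x‖ := norm_mul _ _
    _ < 1 * ‖x‖ := by gcongr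
    _ = ‖x‖ := one_mul _

/-- Every `ℚ_p`-linear functional on `K` is `x ↦ Tr_{K/ℚ_p}(t·x)` (non-degenerate trace form; campaign-S `exists_traceDual_basis`;
the statement of abc-iut-E-t42's Summits-side `PinsIsometricShear.exists_trace_mul_eq`, restated here because `Literature/` cannot import
`Summits/`). [cite: SerreLocalFields1979, Ch. III §3] -/
theorem exists_trace_mul_eq (lam : K →ₗ[ℚ_[p]] ℚ_[p]) : ∃ t : K, ∀ x, Algebra.trace ℚ_[p] K (t * x) = lam x := by
  classical
  haveI := finiteDimensional p K
  obtain ⟨d, hbd⟩ := exists_traceDual_basis (p := p) (Module.finBasis ℚ_[p] K)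
  set b : Module.Basis (Fin (Module.finrank ℚ_[p] K)) ℚ_[p] K := Module.finBasis ℚ_[p] K with hb
  refine ⟨∑ m, lam (b m) • d m, fun x => ?_⟩
  have key : (Algebra.trace ℚ_[p] K) ∘ₗ LinearMap.mulLeft ℚ_[p] (∑ m, lam (b m) • d m) = lam := by
    refine b.ext fun j => ?_
    rw [LinearMap.comp_apply, LinearMap.mulLeft_apply, Finset.sum_mul, map_sum]
    simp_rw [smul_mul_assoc, map_smul, hbd, smul_eq_mul, mul_ite, mul_one, mul_zero]
    rw [Finset.sum_ite_eq Finset.univ j, if_pos (Finset.mem_univ j)]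
  exact LinearMap.congr_fun key x

/-- **ISOMETRIES FIX THE MAXIMAL ORDER on the residual class** — `congr_left_mem_normalizedPacket_of_isometry`: residue field `𝔽₂`
(`‖w − 1‖ < 1` for every unit), a uniformizer `π`, `x₀` with `‖x₀‖ ≤ ‖π‖⁻¹`, `‖Tr x₀‖ ≥ 1` (`d ≤ e`) ⟹ for EVERY `ℚ_p`-linear isometry
`σ` and every `z ∈ (R_I)^∼ ⊆ K ⊗_{ℚ_p} K`: `(σ ⊗ 1)(z) ∈ (R_I)^∼`, in every degree (`σ − 1 = Σ_j Tr(t_j ·)·(σ b_j − b_j)` along a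
norm-dominated basis, each piece strictly contracting, §1–§2).
[cite: Mochizuki2012, IUTchIV Prop. 1.1 p. 9, Prop. 1.4 (i) p. 13] [cite: WeilBNT1967, Ch. II §1, Prop. 3] -/
theorem congr_left_mem_normalizedPacket_of_isometry (hres : ∀ w : K, ‖w‖ = 1 → ‖w - 1‖ < 1)
    (π : K) (hπmax : ∀ y : K, ‖y‖ < 1 → ‖y‖ ≤ ‖π‖) (x₀ : K) (hx₀ : ‖x₀‖ ≤ ‖π‖⁻¹) (htr₀ : 1 ≤ ‖Algebra.trace ℚ_[p] K x₀‖)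
    (σ : K ≃ₗ[ℚ_[p]] K) (hσ : ∀ x, ‖σ x‖ = ‖x‖)
    {z : PacketAlgebra p (fun _ : Fin 2 => K)} (hz : z ∈ normalizedPacket p (fun _ : Fin 2 => K)) :
    (PiTensorProduct.congr (![σ, LinearEquiv.refl ℚ_[p] K] : ∀ _ : Fin 2, K ≃ₗ[ℚ_[p]] K) :
        PacketAlgebra p (fun _ : Fin 2 => K) ≃ₗ[ℚ_[p]] PacketAlgebra p (fun _ : Fin 2 => K)) z ∈
      normalizedPacket p (fun _ : Fin 2 => K) := by
  classical
  haveI := finiteDimensional p K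
  letI : Algebra K (PacketAlgebra p (fun _ : Fin 2 => K)) := (iota p (fun _ : Fin 2 => K) 1).toRingHom.toAlgebra
  have hV : ∀ a : K, algebraMap K (PacketAlgebra p (fun _ : Fin 2 => K)) a = iota p (fun _ : Fin 2 => K) 1 a := fun _ => rfl
  haveI := isScalarTower_star p (fun _ : Fin 2 => K) 1 hV
  obtain ⟨b, hb⟩ := TameDualPair.exists_dominated_basis (p := p) (E := K)
  have ht' : ∀ j : Fin (Module.finrank ℚ_[p] K), ∃ t : K, ∀ x, Algebra.trace ℚ_[p] K (t * x) = b.coord j x :=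
    fun j => exists_trace_mul_eq (b.coord j)
  choose t ht using ht'
  -- each piece is strictly contracting, hence `‖u_j‖·‖t_j‖ ≤ 1`
  have hut : ∀ j, ‖σ (b j) - b j‖ * ‖t j‖ ≤ 1 := by
    intro j
    refine norm_mul_le_one_of_strict π hπmax x₀ hx₀ htr₀ fun x hx => ?_
    rw [ht j x, Module.Basis.coord_apply]
    by_cases hc : b.repr x j = 0
    · rw [hc, norm_zero, zero_mul]; exact norm_pos_iff.mpr hx
    have hlt : ‖σ (b j) - b j‖ < ‖b j‖ := norm_sub_lt_of_isometry hres σ hσ (b.ne_zero j)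
    calc ‖b.repr x j‖ * ‖σ (b j) - b j‖ < ‖b.repr x j‖ * ‖b j‖ := mul_lt_mul_of_pos_left hlt (norm_pos_iff.mpr hc)
      _ = ‖b.repr x j • b j‖ := (norm_smul _ _).symm
      _ ≤ ‖x‖ := hb x j
  -- the decomposition `σ x = x + Σ_j Tr(t_j x) • (σ b_j − b_j)`
  have hdecomp : ∀ x : K, σ x = x + ∑ j, Algebra.trace ℚ_[p] K (t j * x) • (σ (b j) - b j) := by
    intro x
    simp_rw [ht, Module.Basis.coord_apply, smul_sub, Finset.sum_sub_distrib, ← map_smul, ← map_sum, b.sum_repr x]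
    abel
  -- the linear maps `φ_j = ι₀(u_j)·ι₁(Tr_{V/K}(ι₀(t_j)·–))`
  let φ : Fin (Module.finrank ℚ_[p] K) → (PacketAlgebra p (fun _ : Fin 2 => K) →ₗ[ℚ_[p]] PacketAlgebra p (fun _ : Fin 2 => K)) :=
    fun j => LinearMap.mulLeft ℚ_[p] (iota p (fun _ : Fin 2 => K) 0 (σ (b j) - b j)) ∘ₗ
      ((iota p (fun _ : Fin 2 => K) 1).toLinearMap ∘ₗ
        ((Algebra.trace K (PacketAlgebra p (fun _ : Fin 2 => K))).restrictScalars ℚ_[p] ∘ₗ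
          LinearMap.mulLeft ℚ_[p] (iota p (fun _ : Fin 2 => K) 0 (t j))))
  have hφ : ∀ j w, φ j w = iota p (fun _ : Fin 2 => K) 0 (σ (b j) - b j) * iota p (fun _ : Fin 2 => K) 1
      (Algebra.trace K (PacketAlgebra p (fun _ : Fin 2 => K)) (iota p (fun _ : Fin 2 => K) 0 (t j) * w)) := fun j w => rfl
  -- the identity `(σ ⊗ 1) = 1 + Σ_j φ_j`, checked on pure tensors
  have hid : ((PiTensorProduct.congr (![σ, LinearEquiv.refl ℚ_[p] K] : ∀ _ : Fin 2, K ≃ₗ[ℚ_[p]] K) :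
        PacketAlgebra p (fun _ : Fin 2 => K) ≃ₗ[ℚ_[p]] PacketAlgebra p (fun _ : Fin 2 => K)) :
        PacketAlgebra p (fun _ : Fin 2 => K) →ₗ[ℚ_[p]] PacketAlgebra p (fun _ : Fin 2 => K)) = LinearMap.id + ∑ j, φ j := by
    refine PiTensorProduct.ext (MultilinearMap.ext fun w => ?_)
    rw [LinearMap.compMultilinearMap_apply, LinearMap.compMultilinearMap_apply, LinearMap.add_apply, LinearMap.id_apply, LinearMap.sum_apply]
    have hw : PiTensorProduct.tprod ℚ_[p] w = purePacket p (fun _ : Fin 2 => K) ![w 0, w 1] := by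
      rw [purePacket]; congr 1; funext i; fin_cases i <;> rfl
    rw [LinearEquiv.coe_coe, hw, TameQuadratic.congr_purePacket_pair]
    simp only [Matrix.cons_val_zero, Matrix.cons_val_one, LinearEquiv.refl_apply]
    have hsum : ∑ j, φ j (purePacket p (fun _ : Fin 2 => K) ![w 0, w 1]) =
        purePacket p (fun _ : Fin 2 => K) ![∑ j, Algebra.trace ℚ_[p] K (t j * w 0) • (σ (b j) - b j), w 1] := by
      conv_rhs => rw [TameQuadratic.purePacket_pair_eq_iota_mul, map_sum, Finset.sum_mul]
      refine Finset.sum_congr rfl fun j _ => ?_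
      rw [hφ, iota_zero_mul_purePacket_pair, relTrace_purePacket_pair hV, map_smul, mul_smul_comm, map_smul, smul_mul_assoc]
    rw [hsum, hdecomp (w 0), TameQuadratic.purePacket_pair_add_left]
  have hz' := LinearMap.congr_fun hid z
  rw [LinearMap.add_apply, LinearMap.id_apply, LinearMap.sum_apply, LinearEquiv.coe_coe] at hz'
  rw [hz']
  refine (normalizedPacket p (fun _ : Fin 2 => K)).add_mem hz ((normalizedPacket p (fun _ : Fin 2 => K)).sum_mem fun j _ => ?_)
  rw [hφ]
  exact mem_of_rankOne hV (hut j) hz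

/-! ## §4 The second slot (by the symmetric argument) and pairs of isometries -/

/-- `Tr_{V/K}(x ⊗ y) = Tr_{K/ℚ_p}(y)·x` for the `K`-algebra structure through the FIRST slot `a ↦ ι₀(a)` (campaign-S
`relTrace_purePacket` at `* = 0`). [cite: Mochizuki2012, IUTchIV Prop. 1.1 p. 9] -/
theorem relTrace_purePacket_pair_zero [Algebra K (PacketAlgebra p (fun _ : Fin 2 => K))]
    (hV : ∀ a : K, algebraMap K (PacketAlgebra p (fun _ : Fin 2 => K)) a = iota p (fun _ : Fin 2 => K) 0 a) (x y : K) :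
    Algebra.trace K (PacketAlgebra p (fun _ : Fin 2 => K)) (purePacket p (fun _ : Fin 2 => K) ![x, y]) =
      Algebra.trace ℚ_[p] K y • x := by
  classical
  rw [relTrace_purePacket p (fun _ : Fin 2 => K) 0 hV]
  have h01 : (Finset.univ : Finset (Fin 2)).erase 0 = {1} := by decide
  rw [h01, Finset.prod_singleton, Algebra.smul_def, mul_comm]
  rfl

/-- Slot-`1` twin of `mem_of_rankOne`: `ι₁(u)·ι₀(Tr_{V/K}((1 ⊗ t)·z)) ∈ (R_I)^∼` for `z ∈ (R_I)^∼`, `‖u‖·‖t‖ ≤ 1` (trace relative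
to the first slot). [cite: Mochizuki2012, IUTchIV Prop. 1.1 p. 9] [cite: SerreLocalFields1979, Ch. III §3, Prop. 7] -/
theorem mem_of_rankOne_right [Algebra K (PacketAlgebra p (fun _ : Fin 2 => K))]
    (hV : ∀ a : K, algebraMap K (PacketAlgebra p (fun _ : Fin 2 => K)) a = iota p (fun _ : Fin 2 => K) 0 a)
    {u t : K} (hut : ‖u‖ * ‖t‖ ≤ 1) {z : PacketAlgebra p (fun _ : Fin 2 => K)} (hz : z ∈ normalizedPacket p (fun _ : Fin 2 => K)) :
    iota p (fun _ : Fin 2 => K) 1 u *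
        iota p (fun _ : Fin 2 => K) 0
          (Algebra.trace K (PacketAlgebra p (fun _ : Fin 2 => K)) (iota p (fun _ : Fin 2 => K) 1 t * z)) ∈
      normalizedPacket p (fun _ : Fin 2 => K) := by
  by_cases ht : t = 0
  · rw [ht, map_zero, zero_mul, map_zero, map_zero, mul_zero]
    exact Subring.zero_mem _
  set E : PacketAlgebra p (fun _ : Fin 2 => K) := purePacket p (fun _ : Fin 2 => K) ![t⁻¹, t] with hE
  have hEmem : E ∈ normalizedPacket p (fun _ : Fin 2 => K) :=
    purePacket_pair_mem (by rw [norm_inv, inv_mul_cancel₀ (norm_ne_zero_iff.mpr ht)])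
  have hsplit : iota p (fun _ : Fin 2 => K) 1 t * z = iota p (fun _ : Fin 2 => K) 0 t * (E * z) := by
    rw [← mul_assoc, hE, iota_zero_mul_purePacket_pair, mul_inv_cancel₀ ht, TameQuadratic.purePacket_pair_eq_iota_mul, map_one, one_mul]
  have htr : Algebra.trace K (PacketAlgebra p (fun _ : Fin 2 => K)) (iota p (fun _ : Fin 2 => K) 1 t * z) =
      t * Algebra.trace K (PacketAlgebra p (fun _ : Fin 2 => K)) (E * z) := by
    rw [hsplit, ← hV, ← Algebra.smul_def, LinearMap.map_smul, smul_eq_mul]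
  have hr : ‖Algebra.trace K (PacketAlgebra p (fun _ : Fin 2 => K)) (E * z)‖ ≤ 1 :=
    norm_relTrace_le_one p (fun _ : Fin 2 => K) 0 hV ((normalizedPacket p (fun _ : Fin 2 => K)).mul_mem hEmem hz)
  rw [htr, mul_comm, ← TameQuadratic.purePacket_pair_eq_iota_mul]
  refine purePacket_pair_mem ?_
  calc ‖t * Algebra.trace K (PacketAlgebra p (fun _ : Fin 2 => K)) (E * z)‖ * ‖u‖
      = ‖u‖ * ‖t‖ * ‖Algebra.trace K (PacketAlgebra p (fun _ : Fin 2 => K)) (E * z)‖ := by rw [norm_mul]; ring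
    _ ≤ 1 * 1 := by gcongr
    _ = 1 := one_mul 1

/-- **The slot-`1` isometry fixes `(R_I)^∼`** on the residual class (the argument of `congr_left_mem_normalizedPacket_of_isometry` with
the two slots exchanged). [cite: Mochizuki2012, IUTchIV Prop. 1.1 p. 9, Prop. 1.4 (i) p. 13] [cite: WeilBNT1967, Ch. II §1, Prop. 3] -/
theorem congr_right_mem_normalizedPacket_of_isometry (hres : ∀ w : K, ‖w‖ = 1 → ‖w - 1‖ < 1)
    (π : K) (hπmax : ∀ y : K, ‖y‖ < 1 → ‖y‖ ≤ ‖π‖) (x₀ : K) (hx₀ : ‖x₀‖ ≤ ‖π‖⁻¹) (htr₀ : 1 ≤ ‖Algebra.trace ℚ_[p] K x₀‖)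
    (σ : K ≃ₗ[ℚ_[p]] K) (hσ : ∀ x, ‖σ x‖ = ‖x‖)
    {z : PacketAlgebra p (fun _ : Fin 2 => K)} (hz : z ∈ normalizedPacket p (fun _ : Fin 2 => K)) :
    (PiTensorProduct.congr (![LinearEquiv.refl ℚ_[p] K, σ] : ∀ _ : Fin 2, K ≃ₗ[ℚ_[p]] K) :
        PacketAlgebra p (fun _ : Fin 2 => K) ≃ₗ[ℚ_[p]] PacketAlgebra p (fun _ : Fin 2 => K)) z ∈
      normalizedPacket p (fun _ : Fin 2 => K) := by
  classical
  haveI := finiteDimensional p K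
  letI : Algebra K (PacketAlgebra p (fun _ : Fin 2 => K)) := (iota p (fun _ : Fin 2 => K) 0).toRingHom.toAlgebra
  have hV : ∀ a : K, algebraMap K (PacketAlgebra p (fun _ : Fin 2 => K)) a = iota p (fun _ : Fin 2 => K) 0 a := fun _ => rfl
  haveI := isScalarTower_star p (fun _ : Fin 2 => K) 0 hV
  obtain ⟨b, hb⟩ := TameDualPair.exists_dominated_basis (p := p) (E := K)
  have ht' : ∀ j : Fin (Module.finrank ℚ_[p] K), ∃ t : K, ∀ x, Algebra.trace ℚ_[p] K (t * x) = b.coord j x :=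
    fun j => exists_trace_mul_eq (b.coord j)
  choose t ht using ht'
  have hut : ∀ j, ‖σ (b j) - b j‖ * ‖t j‖ ≤ 1 := by
    intro j
    refine norm_mul_le_one_of_strict π hπmax x₀ hx₀ htr₀ fun x hx => ?_
    rw [ht j x, Module.Basis.coord_apply]
    by_cases hc : b.repr x j = 0
    · rw [hc, norm_zero, zero_mul]; exact norm_pos_iff.mpr hx
    have hlt : ‖σ (b j) - b j‖ < ‖b j‖ := norm_sub_lt_of_isometry hres σ hσ (b.ne_zero j)
    calc ‖b.repr x j‖ * ‖σ (b j) - b j‖ < ‖b.repr x j‖ * ‖b j‖ := mul_lt_mul_of_pos_left hlt (norm_pos_iff.mpr hc)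
      _ = ‖b.repr x j • b j‖ := (norm_smul _ _).symm
      _ ≤ ‖x‖ := hb x j
  have hdecomp : ∀ x : K, σ x = x + ∑ j, Algebra.trace ℚ_[p] K (t j * x) • (σ (b j) - b j) := by
    intro x
    simp_rw [ht, Module.Basis.coord_apply, smul_sub, Finset.sum_sub_distrib, ← map_smul, ← map_sum, b.sum_repr x]
    abel
  let φ : Fin (Module.finrank ℚ_[p] K) → (PacketAlgebra p (fun _ : Fin 2 => K) →ₗ[ℚ_[p]] PacketAlgebra p (fun _ : Fin 2 => K)) :=
    fun j => LinearMap.mulLeft ℚ_[p] (iota p (fun _ : Fin 2 => K) 1 (σ (b j) - b j)) ∘ₗ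
      ((iota p (fun _ : Fin 2 => K) 0).toLinearMap ∘ₗ
        ((Algebra.trace K (PacketAlgebra p (fun _ : Fin 2 => K))).restrictScalars ℚ_[p] ∘ₗ
          LinearMap.mulLeft ℚ_[p] (iota p (fun _ : Fin 2 => K) 1 (t j))))
  have hφ : ∀ j w, φ j w = iota p (fun _ : Fin 2 => K) 1 (σ (b j) - b j) * iota p (fun _ : Fin 2 => K) 0
      (Algebra.trace K (PacketAlgebra p (fun _ : Fin 2 => K)) (iota p (fun _ : Fin 2 => K) 1 (t j) * w)) := fun j w => rfl
  have hid : ((PiTensorProduct.congr (![LinearEquiv.refl ℚ_[p] K, σ] : ∀ _ : Fin 2, K ≃ₗ[ℚ_[p]] K) :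
        PacketAlgebra p (fun _ : Fin 2 => K) ≃ₗ[ℚ_[p]] PacketAlgebra p (fun _ : Fin 2 => K)) :
        PacketAlgebra p (fun _ : Fin 2 => K) →ₗ[ℚ_[p]] PacketAlgebra p (fun _ : Fin 2 => K)) = LinearMap.id + ∑ j, φ j := by
    refine PiTensorProduct.ext (MultilinearMap.ext fun w => ?_)
    rw [LinearMap.compMultilinearMap_apply, LinearMap.compMultilinearMap_apply, LinearMap.add_apply, LinearMap.id_apply, LinearMap.sum_apply]
    have hw : PiTensorProduct.tprod ℚ_[p] w = purePacket p (fun _ : Fin 2 => K) ![w 0, w 1] := by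
      rw [purePacket]; congr 1; funext i; fin_cases i <;> rfl
    rw [LinearEquiv.coe_coe, hw, TameQuadratic.congr_purePacket_pair]
    simp only [Matrix.cons_val_zero, Matrix.cons_val_one, LinearEquiv.refl_apply]
    have hsum : ∑ j, φ j (purePacket p (fun _ : Fin 2 => K) ![w 0, w 1]) =
        purePacket p (fun _ : Fin 2 => K) ![w 0, ∑ j, Algebra.trace ℚ_[p] K (t j * w 1) • (σ (b j) - b j)] := by
      conv_rhs => rw [TameQuadratic.purePacket_pair_eq_iota_mul, map_sum, Finset.mul_sum]
      refine Finset.sum_congr rfl fun j _ => ?_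
      rw [hφ, iota_one_mul_purePacket_pair, relTrace_purePacket_pair_zero hV, map_smul, mul_smul_comm, map_smul, mul_smul_comm]
      exact congrArg _ (mul_comm _ _)
    rw [hsum, hdecomp (w 1), TameQuadratic.purePacket_pair_add_right]
  have hz' := LinearMap.congr_fun hid z
  rw [LinearMap.add_apply, LinearMap.id_apply, LinearMap.sum_apply, LinearEquiv.coe_coe] at hz'
  rw [hz']
  refine (normalizedPacket p (fun _ : Fin 2 => K)).add_mem hz ((normalizedPacket p (fun _ : Fin 2 => K)).sum_mem fun j _ => ?_)
  rw [hφ]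
  exact mem_of_rankOne_right hV (hut j) hz

omit [IsUltrametricDist K] [ProperSpace K] in
/-- `f₀ ⊗ f₁ = (f₀ ⊗ 1) ∘ (1 ⊗ f₁)`. [cite: Mochizuki2012, IUTchIV Prop. 1.1 p. 9] -/
theorem congr_eq_congr_left_congr_right (f : ∀ _ : Fin 2, K ≃ₗ[ℚ_[p]] K) (z : PacketAlgebra p (fun _ : Fin 2 => K)) :
    (PiTensorProduct.congr f :
        PacketAlgebra p (fun _ : Fin 2 => K) ≃ₗ[ℚ_[p]] PacketAlgebra p (fun _ : Fin 2 => K)) z =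
      (PiTensorProduct.congr (![f 0, LinearEquiv.refl ℚ_[p] K] : ∀ _ : Fin 2, K ≃ₗ[ℚ_[p]] K) :
        PacketAlgebra p (fun _ : Fin 2 => K) ≃ₗ[ℚ_[p]] PacketAlgebra p (fun _ : Fin 2 => K))
      ((PiTensorProduct.congr (![LinearEquiv.refl ℚ_[p] K, f 1] : ∀ _ : Fin 2, K ≃ₗ[ℚ_[p]] K) :
        PacketAlgebra p (fun _ : Fin 2 => K) ≃ₗ[ℚ_[p]] PacketAlgebra p (fun _ : Fin 2 => K)) z) := by
  induction z using PiTensorProduct.induction_on with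
  | smul_tprod r x =>
    have hx : PiTensorProduct.tprod ℚ_[p] x = purePacket p (fun _ : Fin 2 => K) ![x 0, x 1] := by
      rw [purePacket]; congr 1; funext i; fin_cases i <;> rfl
    rw [hx, map_smul, map_smul, map_smul, TameQuadratic.congr_purePacket_pair, TameQuadratic.congr_purePacket_pair,
      TameQuadratic.congr_purePacket_pair]
    simp only [Matrix.cons_val_zero, Matrix.cons_val_one, LinearEquiv.refl_apply]
  | add x y hx hy => rw [map_add, hx, hy, map_add, map_add]

/-- **EVERY PAIR OF FACTORWISE ISOMETRIES FIXES `(R_I)^∼`** on the residual class (residue field `𝔽₂`, `d ≤ e`), in every degree: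
`(f₀ ⊗ f₁)(z) ∈ (R_I)^∼` for `z ∈ (R_I)^∼`. [cite: Mochizuki2012, IUTchIV Prop. 1.1 p. 9, Prop. 1.4 (i) p. 13] [cite: WeilBNT1967, Ch. II §1, Prop. 3] -/
theorem congr_mem_normalizedPacket_of_isometry (hres : ∀ w : K, ‖w‖ = 1 → ‖w - 1‖ < 1)
    (π : K) (hπmax : ∀ y : K, ‖y‖ < 1 → ‖y‖ ≤ ‖π‖) (x₀ : K) (hx₀ : ‖x₀‖ ≤ ‖π‖⁻¹) (htr₀ : 1 ≤ ‖Algebra.trace ℚ_[p] K x₀‖)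
    (f : ∀ _ : Fin 2, K ≃ₗ[ℚ_[p]] K) (hf : ∀ i x, ‖f i x‖ = ‖x‖)
    {z : PacketAlgebra p (fun _ : Fin 2 => K)} (hz : z ∈ normalizedPacket p (fun _ : Fin 2 => K)) :
    (PiTensorProduct.congr f :
        PacketAlgebra p (fun _ : Fin 2 => K) ≃ₗ[ℚ_[p]] PacketAlgebra p (fun _ : Fin 2 => K)) z ∈
      normalizedPacket p (fun _ : Fin 2 => K) := by
  rw [congr_eq_congr_left_congr_right]
  exact congr_left_mem_normalizedPacket_of_isometry hres π hπmax x₀ hx₀ htr₀ (f 0) (hf 0)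
    (congr_right_mem_normalizedPacket_of_isometry hres π hπmax x₀ hx₀ htr₀ (f 1) (hf 1) hz)

/-- **NO ISOMETRIC MOVER on the residual class** (negation of the `hmove` shape of the abc-iut cell's `Joshi/TestRealPinsMaxOrderMover`;
every degree; compare `DyadicDiffTwo.not_exists_isometry_mover`). [cite: Mochizuki2012, IUTchIV Prop. 1.1 p. 9, Prop. 1.4 (i) p. 13] -/
theorem not_exists_isometry_mover (hres : ∀ w : K, ‖w‖ = 1 → ‖w - 1‖ < 1)
    (π : K) (hπmax : ∀ y : K, ‖y‖ < 1 → ‖y‖ ≤ ‖π‖) (x₀ : K) (hx₀ : ‖x₀‖ ≤ ‖π‖⁻¹) (htr₀ : 1 ≤ ‖Algebra.trace ℚ_[p] K x₀‖) :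
    ¬ ∃ (f : ∀ _ : Fin 2, K ≃ₗ[ℚ_[p]] K) (z : PacketAlgebra p (fun _ : Fin 2 => K)),
      (∀ i x, ‖f i x‖ = ‖x‖) ∧ z ∈ normalizedPacket p (fun _ : Fin 2 => K) ∧
        (PiTensorProduct.congr f :
          PacketAlgebra p (fun _ : Fin 2 => K) ≃ₗ[ℚ_[p]] PacketAlgebra p (fun _ : Fin 2 => K)) z ∉
          normalizedPacket p (fun _ : Fin 2 => K) := by
  rintro ⟨f, z, hf, hz, hnot⟩
  exact hnot (congr_mem_normalizedPacket_of_isometry hres π hπmax x₀ hx₀ htr₀ f hf hz)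

end DyadicPrimeResidue

end Literature.IUT.LogVolume

end
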